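import Summits.CriticalPhenomena.PercolationContinuityZ3.Theorems.PercShatteringRaceRaceLemma
import Summits.CriticalPhenomena.PercolationContinuityZ3.Theses.PercHyperscalingGluing
import Literature.Probability.Percolation.ConnectivityThetaSqProofs
import HarnessLib

/-!
# Route PercShatteringRace — the LINEAR race from quasi-locality (line critical-orange-peeling)

Consumed forms `C1`, `C2` of the crux `NearLinearTwoClusterDecay` (item
`stmt-CriticalPhenomena-5785`): the planners' replacement of the polynomial-aspect two-cluster
decay `U(b)` by centre-rooted quasi-locality

  `QL_M(c)`: for all `n` and all `y ∈ Λ_n`,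
    `c · P_{p_c}(0 ↔ y) ≤ P_{p_c}(0 ↔ y inside Λ_{M n})`   (`M ≥ 1`, `c > 0`),

for bond percolation on `ℤ³` at `p_c` (measure `bondPercolation (zdGraph 3) (criticalProbI 3)`,
`Λ_m = box 3 m`, "inside" = `openConnIn ↑(box 3 (M n))`).

* `linearRace_of_quasiLocality` (C1): `QL_M(c)` and the free-box susceptibility power saving
  `S(a) : Σ_{y ∈ Λ_R} P(0 ↔ y inside Λ_R) ≤ C R^{3-a}` (`R ≥ 1`) for ANY `a > 0` give
  `θ(p_c) = 0` (`PercolationContinuityZ3`). No exponent budget: the race is linear (`R = M n`).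
* `percolationContinuityZ3_of_quasiLocality_of_freeBoxShattering` (C2): `QL_M(c)` and free-box
  shattering `F_r := |Λ_r|⁻¹ Σ_{x ∈ Λ_r} P(0 ↔ x inside Λ_r) → 0`
  (`PercHyperscalingGluing.FreeBoxShattering`, item `stmt-CriticalPhenomena-4644`) give
  `θ(p_c) = 0`.

Proof sketch (both): if `θ := θ(p_c) ≠ 0` then `θ > 0`, and for every `n` and `y ∈ Λ_n`,
`c θ² ≤ c P(0 ↔ y) ≤ P(0 ↔ y inside Λ_{Mn})` (`τ ≥ θ²`, Grimmett 1999 §8.5, in tree as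
`Grimmett1999_theta_sq_le_openConn_holds`, then `QL_M`). Summing over `y ∈ Λ_n ⊆ Λ_{Mn}`:
`(2n+1)³ c θ² ≤ Σ_{y ∈ Λ_{Mn}} P(0 ↔ y inside Λ_{Mn})` (`sum_box_lower_of_quasiLocality`).
* C1: the right side is `≤ C (M n)^{3-a} ≤ |C| M^{3-a} n^{3-a}` by `S(a)` at `R = M n ≥ 1`, while
  the left side is `≥ n³ c θ² = n^a · n^{3-a} c θ²`; `n^a → ∞` (`tendsto_rpow_atTop`) gives the
  contradiction — the summation / exponent-race blocks of `Theorems.raceLemma_proof`.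
* C2: the right side equals `|Λ_{Mn}| F_{Mn} ≤ (2M)³ (2n+1)³ F_{Mn}` (`(2Mn+1) ≤ 2M(2n+1)`), so
  `c θ² ≤ (2M)³ F_{Mn}` for all `n ≥ 1`; `F_{Mn} → 0` along `n ↦ M n → ∞` forces `c θ² ≤ 0` —
  the gluing block of `PercHyperscalingGluing.closes`.

Tree inputs: `Grimmett1999_theta_sq_le_openConn_holds` (`ConnectivityThetaSqProofs.lean`),
`card_box`, `box_mono` (`ThermodynamicLimit.lean`); Mathlib `tendsto_rpow_atTop`, `Real.mul_rpow`,
`Real.rpow_add`, `Real.rpow_natCast`, `ge_of_tendsto`.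
-/

noncomputable section

namespace Summit.CriticalPhenomena.PercolationContinuityZ3.Theorems.NearLinearTwoClusterDecay.Consumed

open MeasureTheory Filter Topology
open Literature.Probability.LatticeModels Literature.Probability.Percolation

/-- **Summed quasi-locality lower bound.** Under centre-rooted quasi-locality `QL_M(c)` with
`M ≥ 1`, `c ≥ 0`, for every `n`:
`(2n+1)³ · c θ(p_c)² ≤ Σ_{y ∈ Λ_{Mn}} P_{p_c}(0 ↔ y inside Λ_{Mn})` on `ℤ³` — pointwise
`c θ² ≤ c P(0 ↔ y) ≤ P(0 ↔ y inside Λ_{Mn})` for `y ∈ Λ_n` (`τ ≥ θ²`, Grimmett 1999 §8.5, then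
`QL_M`), summed over `Λ_n ⊆ Λ_{Mn}` with nonnegative extra terms. [folklore] -/
private theorem sum_box_lower_of_quasiLocality {M : ℕ} {c : ℝ} (hM : 1 ≤ M) (hc : 0 ≤ c)
    (hQL : ∀ n : ℕ, ∀ y ∈ box 3 n,
      c * (bondPercolation (zdGraph 3) (criticalProbI 3)).real (openConn (0 : Site 3) y) ≤
        (bondPercolation (zdGraph 3) (criticalProbI 3)).real
          (openConnIn (↑(box 3 (M * n)) : Set (Site 3)) 0 y))
    (n : ℕ) :
    (((2 * n + 1) ^ 3 : ℕ) : ℝ) * (c * theta (zdGraph 3) (0 : Site 3) (criticalProbI 3) ^ 2) ≤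
      ∑ y ∈ box 3 (M * n), (bondPercolation (zdGraph 3) (criticalProbI 3)).real
        (openConnIn (↑(box 3 (M * n)) : Set (Site 3)) 0 y) := by
  have hsub : box 3 n ⊆ box 3 (M * n) :=
    box_mono 3 (le_mul_of_one_le_left (Nat.zero_le n) hM)
  calc (((2 * n + 1) ^ 3 : ℕ) : ℝ) * (c * theta (zdGraph 3) (0 : Site 3) (criticalProbI 3) ^ 2)
      = ∑ _y ∈ box 3 n, c * theta (zdGraph 3) (0 : Site 3) (criticalProbI 3) ^ 2 := by
        rw [Finset.sum_const, card_box, nsmul_eq_mul]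
    _ ≤ ∑ y ∈ box 3 n, (bondPercolation (zdGraph 3) (criticalProbI 3)).real
          (openConnIn (↑(box 3 (M * n)) : Set (Site 3)) 0 y) :=
        Finset.sum_le_sum fun y hy =>
          (mul_le_mul_of_nonneg_left
            (Grimmett1999_theta_sq_le_openConn_holds 3 (criticalProbI 3) 0 y) hc).trans (hQL n y hy)
    _ ≤ ∑ y ∈ box 3 (M * n), (bondPercolation (zdGraph 3) (criticalProbI 3)).real
          (openConnIn (↑(box 3 (M * n)) : Set (Site 3)) 0 y) :=
        Finset.sum_le_sum_of_subset_of_nonneg hsub fun _ _ _ => measureReal_nonneg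

/-- **C1 — the linear race** (line critical-orange-peeling, consumed form of
`NearLinearTwoClusterDecay`): centre-rooted quasi-locality `QL_M(c)` (`M ≥ 1`, `c > 0`:
`c P_{p_c}(0 ↔ y) ≤ P_{p_c}(0 ↔ y inside Λ_{Mn})` for `y ∈ Λ_n`) together with the free-box
susceptibility power saving `S(a)` for ANY `a > 0` gives `θ(p_c) = 0` on `ℤ³`. If `θ > 0`:
`n³ c θ² ≤ (2n+1)³ c θ² ≤ Σ_{y ∈ Λ_{Mn}} P(0 ↔ y inside Λ_{Mn}) ≤ C (Mn)^{3-a} ≤ |C| M^{3-a} n^{3-a}`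
for all `n ≥ 1`, contradicting `n^a → ∞`. [folklore] -/
theorem linearRace_of_quasiLocality : ∀ (M : ℕ) (c : ℝ), 1 ≤ M → 0 < c →
    (∀ n : ℕ, ∀ y ∈ box 3 n,
      c * (bondPercolation (zdGraph 3) (criticalProbI 3)).real (openConn (0 : Site 3) y) ≤
        (bondPercolation (zdGraph 3) (criticalProbI 3)).real (openConnIn (↑(box 3 (M * n)) : Set (Site 3)) 0 y)) →
    ∀ a : ℝ, 0 < a →
    (∃ C : ℝ, ∀ R : ℕ, 1 ≤ R → ∑ y ∈ box 3 R,
      (bondPercolation (zdGraph 3) (criticalProbI 3)).real (openConnIn (↑(box 3 R) : Set (Site 3)) 0 y)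
        ≤ C * (R : ℝ) ^ (3 - a)) →
    _root_.PercolationContinuityZ3 := by
  intro M c hM hc hQL a ha hS
  show theta (zdGraph 3) (0 : Site 3) (criticalProbI 3) = 0
  by_contra hne
  have hlow := sum_box_lower_of_quasiLocality hM hc.le hQL
  have hθ : 0 < theta (zdGraph 3) (0 : Site 3) (criticalProbI 3) :=
    lt_of_le_of_ne measureReal_nonneg (Ne.symm hne)
  set μ := bondPercolation (zdGraph 3) (criticalProbI 3) with hμ
  set θ := theta (zdGraph 3) (0 : Site 3) (criticalProbI 3) with hθdef
  obtain ⟨C, hC⟩ := hS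
  have hcθ : 0 < c * θ ^ 2 := by positivity
  -- the linear race: `(2n+1)³ c θ² ≤ C (M n)^{3-a} ≤ |C| M^{3-a} n^{3-a}` for all `n ≥ 1`
  have hmain : ∀ n : ℕ, 1 ≤ n →
      (((2 * n + 1) ^ 3 : ℕ) : ℝ) * (c * θ ^ 2) ≤ |C| * (M : ℝ) ^ (3 - a) * (n : ℝ) ^ (3 - a) := by
    intro n hn
    have hR1 : 1 ≤ M * n := hn.trans (le_mul_of_one_le_left (Nat.zero_le n) hM)
    have h3 : C * ((M * n : ℕ) : ℝ) ^ (3 - a) ≤ |C| * (M : ℝ) ^ (3 - a) * (n : ℝ) ^ (3 - a) := by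
      rw [Nat.cast_mul, Real.mul_rpow (Nat.cast_nonneg M) (Nat.cast_nonneg n), ← mul_assoc]
      exact mul_le_mul_of_nonneg_right
        (mul_le_mul_of_nonneg_right (le_abs_self C) (Real.rpow_nonneg (Nat.cast_nonneg M) _))
        (Real.rpow_nonneg (Nat.cast_nonneg n) _)
    exact (hlow n).trans ((hC (M * n) hR1).trans h3)
  -- contradiction: `n³ c θ² ≤ (2n+1)³ c θ² ≤ K n^{3-a}` with `K = |C| M^{3-a}`, `a > 0`
  set K : ℝ := |C| * (M : ℝ) ^ (3 - a) with hK
  have htend : Tendsto (fun n : ℕ => (n : ℝ) ^ a) atTop atTop :=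
    (tendsto_rpow_atTop ha).comp tendsto_natCast_atTop_atTop
  obtain ⟨n, hbig, hn1⟩ :=
    ((htend.eventually_gt_atTop (K / (c * θ ^ 2))).and (eventually_ge_atTop 1)).exists
  have hnpos : (0 : ℝ) < n := by exact_mod_cast hn1
  have hns : 0 < (n : ℝ) ^ (3 - a) := Real.rpow_pos_of_pos hnpos _
  have h3 : (n : ℝ) ^ (3 : ℝ) = (n : ℝ) ^ a * (n : ℝ) ^ (3 - a) := by
    rw [← Real.rpow_add hnpos]
    congr 1
    ring
  have h3' : (n : ℝ) ^ (3 : ℝ) = ((n ^ 3 : ℕ) : ℝ) := by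
    rw [show (3 : ℝ) = ((3 : ℕ) : ℝ) by norm_num, Real.rpow_natCast]
    push_cast
    rfl
  have hcube : ((n ^ 3 : ℕ) : ℝ) ≤ (((2 * n + 1) ^ 3 : ℕ) : ℝ) := by
    exact_mod_cast Nat.pow_le_pow_left (by omega : n ≤ 2 * n + 1) 3
  have hK' : K < c * θ ^ 2 * (n : ℝ) ^ a := by
    have := (div_lt_iff₀ hcθ).1 hbig
    linarith
  have hlt : K * (n : ℝ) ^ (3 - a) < (((2 * n + 1) ^ 3 : ℕ) : ℝ) * (c * θ ^ 2) :=
    calc K * (n : ℝ) ^ (3 - a) < (c * θ ^ 2 * (n : ℝ) ^ a) * (n : ℝ) ^ (3 - a) :=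
          mul_lt_mul_of_pos_right hK' hns
      _ = ((n ^ 3 : ℕ) : ℝ) * (c * θ ^ 2) := by rw [← h3', h3]; ring
      _ ≤ (((2 * n + 1) ^ 3 : ℕ) : ℝ) * (c * θ ^ 2) :=
          mul_le_mul_of_nonneg_right hcube hcθ.le
  exact absurd (hmain n hn1) (not_le.2 hlt)

/-- **C2 — quasi-locality plus free-box shattering** (line critical-orange-peeling, consumed form
of `NearLinearTwoClusterDecay`): centre-rooted quasi-locality `QL_M(c)` (`M ≥ 1`, `c > 0`)
together with free-box shattering `F_r = |Λ_r|⁻¹ Σ_{x ∈ Λ_r} P_{p_c}(0 ↔ x inside Λ_r) → 0`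
(`PercHyperscalingGluing.FreeBoxShattering`, item `stmt-CriticalPhenomena-4644`) gives
`θ(p_c) = 0` on `ℤ³`. If `θ > 0`: `(2n+1)³ c θ² ≤ Σ_{y ∈ Λ_{Mn}} P(0 ↔ y inside Λ_{Mn})
= |Λ_{Mn}| F_{Mn} ≤ (2M)³ (2n+1)³ F_{Mn}`, so `c θ² ≤ (2M)³ F_{Mn} → 0` along `n ↦ Mn`. [folklore] -/
theorem percolationContinuityZ3_of_quasiLocality_of_freeBoxShattering : ∀ (M : ℕ) (c : ℝ), 1 ≤ M → 0 < c →
    (∀ n : ℕ, ∀ y ∈ box 3 n,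
      c * (bondPercolation (zdGraph 3) (criticalProbI 3)).real (openConn (0 : Site 3) y) ≤
        (bondPercolation (zdGraph 3) (criticalProbI 3)).real (openConnIn (↑(box 3 (M * n)) : Set (Site 3)) 0 y)) →
    Summit.CriticalPhenomena.PercolationContinuityZ3.Theses.PercHyperscalingGluing.FreeBoxShattering →
    _root_.PercolationContinuityZ3 := by
  intro M c hM hc hQL hF
  show theta (zdGraph 3) (0 : Site 3) (criticalProbI 3) = 0
  by_contra hne
  have hlow := sum_box_lower_of_quasiLocality hM hc.le hQL
  have hθ : 0 < theta (zdGraph 3) (0 : Site 3) (criticalProbI 3) :=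
    lt_of_le_of_ne measureReal_nonneg (Ne.symm hne)
  set μ := bondPercolation (zdGraph 3) (criticalProbI 3) with hμ
  set θ := theta (zdGraph 3) (0 : Site 3) (criticalProbI 3) with hθdef
  set F : ℕ → ℝ := fun r : ℕ => ((box 3 r).card : ℝ)⁻¹ *
      ∑ x ∈ box 3 r, μ.real (openConnIn (↑(box 3 r) : Set (Site 3)) 0 x) with hFdef
  have hF' : Tendsto F atTop (𝓝 0) := hF
  have hcθ : 0 < c * θ ^ 2 := by positivity
  -- the key finite-`n` inequality `c θ² ≤ (2M)³ F (M n)`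
  have key : ∀ n : ℕ, 1 ≤ n → c * θ ^ 2 ≤ (2 * (M : ℝ)) ^ 3 * F (M * n) := by
    intro n hn
    have hX : (0 : ℝ) < (((2 * n + 1) ^ 3 : ℕ) : ℝ) := by positivity
    have hcard : ((box 3 (M * n)).card : ℝ) = (2 * ((M : ℝ) * n) + 1) ^ 3 := by
      rw [card_box]; push_cast; ring
    have hcard_pos : (0 : ℝ) < ((box 3 (M * n)).card : ℝ) := by rw [hcard]; positivity
    have h4 : ∑ x ∈ box 3 (M * n), μ.real (openConnIn (↑(box 3 (M * n)) : Set (Site 3)) 0 x)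
        = ((box 3 (M * n)).card : ℝ) * F (M * n) := by
      simp only [hFdef]
      rw [← mul_assoc, mul_inv_cancel₀ hcard_pos.ne', one_mul]
    have hFn : 0 ≤ F (M * n) := by
      simp only [hFdef]
      exact mul_nonneg (inv_nonneg.2 hcard_pos.le)
        (Finset.sum_nonneg fun _ _ => measureReal_nonneg)
    -- ratio of volumes `|Λ_{Mn}| ≤ (2M)³ (2n+1)³` (uses `M ≥ 1`)
    have hratio : ((box 3 (M * n)).card : ℝ) ≤
        (((2 * n + 1) ^ 3 : ℕ) : ℝ) * (2 * (M : ℝ)) ^ 3 := by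
      rw [hcard]; push_cast; rw [← mul_pow]
      apply pow_le_pow_left₀ (by positivity)
      have hM1 : (1 : ℝ) ≤ M := by exact_mod_cast hM
      have hn0 : (0 : ℝ) ≤ n := Nat.cast_nonneg n
      nlinarith
    refine le_of_mul_le_mul_left ?_ hX
    calc (((2 * n + 1) ^ 3 : ℕ) : ℝ) * (c * θ ^ 2)
        ≤ ∑ x ∈ box 3 (M * n), μ.real (openConnIn (↑(box 3 (M * n)) : Set (Site 3)) 0 x) :=
          hlow n
      _ = ((box 3 (M * n)).card : ℝ) * F (M * n) := h4
      _ ≤ (((2 * n + 1) ^ 3 : ℕ) : ℝ) * (2 * (M : ℝ)) ^ 3 * F (M * n) :=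
          mul_le_mul_of_nonneg_right hratio hFn
      _ = (((2 * n + 1) ^ 3 : ℕ) : ℝ) * ((2 * (M : ℝ)) ^ 3 * F (M * n)) := by ring
  -- `F (M n) → 0` along `n ↦ M n → ∞`
  have hMn : Tendsto (fun n : ℕ => M * n) atTop atTop :=
    tendsto_atTop_mono (fun n => le_mul_of_one_le_left (Nat.zero_le n) hM) tendsto_id
  have hlim : Tendsto (fun n : ℕ => (2 * (M : ℝ)) ^ 3 * F (M * n)) atTop (𝓝 0) := by
    have := (hF'.comp hMn).const_mul ((2 * (M : ℝ)) ^ 3)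
    simpa using this
  have hle : c * θ ^ 2 ≤ 0 := ge_of_tendsto hlim (eventually_atTop.2 ⟨1, key⟩)
  exact absurd hle (not_le.2 hcθ)

end Summit.CriticalPhenomena.PercolationContinuityZ3.Theorems.NearLinearTwoClusterDecay.Consumed
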